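import Summits.QuantumFields.YangMills.Theorems.BalabanUVNodesK0AxDecayBoxD9

/-!
# BalabanUVNodes — K0ᴬ road, PART 2∕2 of ★ P3 №9 v2.1: the K0ᴬ–K1ᴬ JUNCTION's socket body and its binder `hβc` from D1 AT EVERY BOX HISTORY + the chart rows of ONE `ιC`
  + (V-cont-box) + a signed floor letter — NO moment letter, NO decay letter, NO (1.21) letter, NO token  (★ P3 g90 `ym-nodeO-ideate-p3`, LENS P3 «weaken the target»; tree names only)

LANDING NOTE (porter ▶ PTC-1 g4, 2026-08-31; AUTHORSHIP = ★ P3 g90 «weaken the target», HOME sketch `nodeO-cover/P3-K0AxDecayBoxLocUniv-v2p1-B.lean` sha16 dbccba36ab479bcc · 222 l. · 5 thm · 0 def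
· 0 sorry = PART 2∕2 of P3's own 2-file cut of OFFER №9 v2.1 (§11h–§11i: the K0ᴬ–K1ᴬ junction socket body and doors); imports PART 1 ✓`…K0AxDecayBoxD9`): landed VERBATIM (only this paragraph
added) under P3's basename (`…K0AxDecayBoxD9Junction`) on OFFER №9 (nodeO STATUS 10:20:55Z); ◆ CRIT-1 g37's cut + (Q-ord) toy: CUT ×3 GO (nodeO STATUS 2026-08-31T10:44:10Z): combined farm run of
№9A+№9B+№10 rc 0 · 0 warn · 0 sorry, axioms standard through №10's last door, dedup 16∕16 fresh, (Q-ord) PASS (every `∃ C₉ δ₀`∕`∃ C δ₁`∕`∃ M` closed inside after `δ₀` is revealed), J1′∕J5′ PASS,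
SAME-WALL: located-genuine CONDITIONAL helpers whose price is every conjunct of `H` OPEN — incl. the one honest gap the files name themselves: D1 is asked at every BOX history while ⁸∕⟨27930⟩ as
signed delivers RUNS (Q-25, ★★★'s pen); helper `--supports stmt-QuantumFields-27238 --as helper` (NO
`--workitem`).  HONEST (porter): CONDITIONAL theorems over DISPLAYED row predicates + by-name doors from displayed hypotheses; (E-lu-box) ∕ (L-dec-box) ∕ [E] inhabited unconditionally NOWHERE;
D1-on-the-box, the chart rows of ONE `ιC`, (V-cont-box) ∕ (V-hess-cont-box), the sign letters — all OPEN Bałaban-strength content, asserted nowhere; nothing of Bałaban asserted, ported, discharged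
or refuted; K0ᴬ stmt-QuantumFields-27238 OPEN — NOTHING of it proved; NODE O 0∕1; COUNT 8∕28 · K 1∕4 UNMOVED; finite 𝕋⁴ at fixed ε — NOT continuum ∕ OS ∕ Clay; the Yang–Mills mass gap is NOT
proved by any of this.

THIS FILE = §11h∕§11i of №9 v2.1 (`nodeO-cover/P3-K0AxDecayBoxLocUniv-v2p1.lean` 0a97afe1ffcbeff5), split off under the gate's 400-line cap; PART 1∕2 = ✓`…Theorems/BalabanUVNodesK0AxDecayBoxD9`
(§11a–§11g: the generic-table (5.10) road `recordDecay_of_trace_G`, (L-dec-box) ★★★`plimDecayOnBoxOf_LocUniv_images_geom` and (L-absmom-box) ★★★`absMomentBox_LocUniv_images_geom` from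
D1-box + the chart rows through ★ PTB-1's ✓`twoVolExpBox_LocUniv_images_geom`, and the moment-free K0ᴬ door ★`record13SepCoPHInhabitedAx_of_chartRowsBox_cofinalRadii`); WHY∕DEDUP∕(Q-ord)
exactly as in PART 1's header.
* §11h ★★ `cofinalBetaSocketAxBody_of_chartRowsBox_contBox_negPart` (+ `…_eventuallyNonneg`) — THE K0ᴬ–K1ᴬ JUNCTION EDITION: at ONE radius, D1-box ∧ chart rows ∧ (V-cont-box)
  `RecordPvolContOnBoxAx` ∧ (L-negpart-box) `RecordPlimMomentNegPartOnBoxAx … e` (resp. (L-AF-box)) ⟹ `CofinalBetaSocketAxBody F a` — (L-absmom-box) by §11f, (L-dom-box) by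
  ✓`recordPlimMomentDominatedOnBoxAx_of_decayBox` from (L-dec-box), (L-cont-box) by ✓`recordPlimContOnBoxAx_of_pvol_loc` from (V-cont-box) + the Cauchy half of (E-lu-box).
* §11i ★ `cofinalBetaSocketAxBody_allRadii_of_chartRowsBox_contBox_negPart_cofinalRadii` — §11h at cofinally small radii ⟹ `∀ F a, 0 < a → CofinalBetaSocketAxBody F a` — the junction's
  `hβc` VERBATIM; ★ `record13SepCoPHInhabitedAx_of_chartRowsBox_contBox_negPart_cofinalRadii` ∕ ★ `…_contBox_eventuallyNonneg_cofinalRadii` — K0ᴬ BY NAME through it (both sign editions).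

HONEST STATUS.  CONDITIONAL helpers over DISPLAYED rows, each OPEN Bałaban-strength content (D1-box = W1 ⟨27930⟩'s consequent AT EVERY BOX HISTORY — ⁸ signs RUNS, G-P3-6-1∕Q-25; the chart rows
⟸ (ra-1)(ra-3)(ra-4) + `DressLink` ⟸ (C-orb); (V-cont-box); the sign letter).  Nothing of Bałaban's renormalization-group analysis is asserted, ported, discharged or refuted; K0ᴬ
`Record13SepCoPHInhabitedAx` (stmt-QuantumFields-27238) OPEN; 27930 ∕ 26648 OPEN; NODE O 0∕1; COUNT 8∕28 · K 1∕4 UNMOVED; finite 𝕋⁴_{L^K} at fixed ε — NOT continuum ∕ OS ∕ Clay;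
**the Yang–Mills mass gap (Clay) is NOT proved.**

References: T. Bałaban, *Renormalization group approach to lattice gauge field theories. I*, Comm. Math. Phys. 109 (1987) 249–301 [Balaban1987RG1] — Thm 1 p.259, Thm 2 (0.31) p.259,
Thm 3 p.264, (1.18)–(1.22) pp.263–264, p.266, (5.10) p.293, (5.38)–(5.44) pp.296–297; T. Bałaban, *The variational problem and background fields in renormalization group method for
lattice gauge theories*, Comm. Math. Phys. 102 (1985) 277–309 [Balaban1985Variational] — Prop. 9 p.309.
-/

noncomputable section

open Filter Topology
open scoped BigOperators Matrix.Norms.L2Operator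

namespace Summit.QuantumFields.YangMills.Theorems.K0AxMomentRoad

open Literature.MathematicalPhysics.QuantumFieldTheory.Balaban1983to89
open Literature.MathematicalPhysics.QuantumFieldTheory.Balaban1983to89.Node00 (TermFamily1 siteOfInt polWindow polScalar betaOfRecord₁₃Ax Stage13Params PolLimitExists)
open Literature.MathematicalPhysics.QuantumFieldTheory.Balaban1983to89.T4Continuum (T4Family)
open Literature.MathematicalPhysics.QuantumFieldTheory.Balaban1983to89.B12FormatPlus
open Literature.MathematicalPhysics.QuantumFieldTheory.Balaban1983to89.B12Decay510 (SiteGeometry GeomLeaf CubeSumLeaf TreeLeaf KernelBound delta1 delta1_pos mixedDeriv)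
open Summit.QuantumFields.YangMills.Theorems.K0RecordFormatNames (ΦfOf pvolOf plimOf PlimDecayOnBoxOf PolLimitOnBoxOf)
open Summit.QuantumFields.YangMills.Theorems.PortH (exists_cutTo_clm pvolOf_eq_trace)
open Summit.QuantumFields.YangMills.Theorems.K0RecordFormatNames
open Summit.QuantumFields.YangMills.Theorems.PortHRecordJoin (formatPlusG_chartSwap chartEquivariant_members noInvariantCovector_members chart_cut limit121_members l1_neg
  kappa₀_std_pos)
open Summit.QuantumFields.YangMills.Theorems.K0PortChart44DAtRecord (chart44DJ_record)
open Summit.QuantumFields.YangMills.Theorems.K0AxJoinT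
open Summit.QuantumFields.YangMills.Theorems.PortHRecordRowG (rowG_slot8_at_names mc_pos)
open Literature.MathematicalPhysics.QuantumFieldTheory.Balaban1983to89.FlowStep
open Literature.MathematicalPhysics.QuantumFieldTheory.Balaban1983to89.FlowStepRuns

/-! ## §11h  The K0ᴬ–K1ᴬ JUNCTION socket body from D1-box + the chart rows + (V-cont-box) + the signed floor letter (no token) -/

/-- ★★ **THE JUNCTION SOCKET BODY FROM D1-box + THE CHART ROWS + (V-cont-box) + (L-negpart-box) — NO TOKEN** — at ONE radius `0 < a₀ ≤ a`, level `0 < γ₀ ≤ ½`, `ε₂₉ > 0`: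
D1-box ∧ the chart rows of ONE `ιC` give (L-dec-box) (§11e) and (E-lu-box) (✓`twoVolExpBox_LocUniv_images_geom`), hence (L-absmom-box)
(✓`recordPlimAbsMomentOnBoxAx_of_plimDecayOnBoxOf`), (L-dom-box) (✓`recordPlimMomentDominatedOnBoxAx_of_decayBox`), (L-lim-box) ∧ (V-lucauchy-box) (✓`polLimitOnBoxOf_of_twoVolExpLocUnif`,
✓`recordPvolLocUniformCauchyOnBoxAx_of_twoVolExpLocUnif`) and with the displayed finite-volume continuity (V-cont-box) also (L-cont-box) (✓`recordPlimContOnBoxAx_of_pvol_loc`); with the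
displayed (L-negpart-box) `e` the four letters inhabit `CofinalBetaSocketAxBody F a` (✓`cofinalBetaSocketAxBody_of_plimBoxLetters`: box `β′ := M`, row (i), floor (iv) `Σ' e`, continuity (C)).
NET FOR THE JUNCTION: of its limit-kernel letters only the finite-volume continuity (V-cont-box) and the signed floor letter (L-negpart-box) (or (L-AF-box), next theorem) stay
displayed beside the K0ᴬ rows.  CONDITIONAL; every row OPEN Bałaban-strength content; nothing of Bałaban asserted; the junction's consumer and K0ᴬ 27238 remain OPEN; the
Yang–Mills mass gap is NOT proved. [cite: Balaban1987RG1, Thm 1 p.259, Thm 2 (0.31) p.259, Thm 3 p.264, (0.20) p.256, (1.18)–(1.22) pp.263–264, (5.10) p.293, (5.38)–(5.44) pp.296–297; Balaban1985Variational, Prop. 9 p.309] -/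
theorem cofinalBetaSocketAxBody_of_chartRowsBox_contBox_negPart {E₀ κ Mg a : ℝ} {e : ℕ → ℝ}
    (hE₀ : 0 ≤ E₀) (hκ₀ : 4 * B12TreeDecay.kappa₀ (4 * 2 ^ 4) (2 * 4) ≤ κ) :
    ∀ (F : T4Family) (a₀ ε₂₉ γ₀ α₀ α₁ : ℝ), 0 < a₀ → a₀ ≤ a → 0 < γ₀ → γ₀ ≤ 1 / 2 → 0 < ε₂₉ → 0 < α₀ → 0 < α₁ →
      ∀ Mc : ℕ, McGuard F Mc → 4 * (Mc : ℝ) ≤ Mg →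
      letI θ := thetaFill F a₀ ε₂₉; letI := θ.instVβ₁; letI := θ.instVβ₂; letI := θ.instιβ
      ∀ ιC : (k n : ℕ) → recordW F a₀ ε₂₉ k (recordK₀ F Mc k + n) → (Fin (recordChartDimJ F (recordK₀ F Mc k + n)) → ℂ),
      (∀ (k : ℕ) (v : Fin (k + 1) → ℝ), v ∈ FlowStep.Box γ₀ k →
        B12FormatPlus.FormatPlusG (fun n => recordDomSys F Mc k (recordK₀ F Mc k + n)) (fun n => recordBondCount F (recordK₀ F Mc k + n))
          (fun n => recordAct F (recordK₀ F Mc k + n)) (fun n => recordUc F Mc k α₀ α₁ (recordK₀ F Mc k + n))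
          (fun n => recordCoords F Mc k (recordK₀ F Mc k + n)) (fun n => recordChartDimJ F (recordK₀ F Mc k + n))
          (fun n => recordChartJ F Mc k (recordK₀ F Mc k + n)) (fun n => recordΦfAx F a₀ ε₂₉ k v (recordK₀ F Mc k + n))
          (fun n => recordEmbJ F θ k (recordK₀ F Mc k + n)) (fun n => recordWrapCtr F Mc k (recordK₀ F Mc k + n))
          (fun n => recordDomEmbCtr F Mc k (recordK₀ F Mc k + n)) (fun n _ => recordCoordProjCtr F (recordK₀ F Mc k + n)) E₀ κ) →
      (∀ (k n : ℕ), ∀ᶠ B in 𝓝 (0 : recordW F a₀ ε₂₉ k (recordK₀ F Mc k + n)), ∀ X : (recordDomSys F Mc k (recordK₀ F Mc k + n)).Dom,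
          ∃ g : recordGaugeGrp F (recordK₀ F Mc k + n), ∀ i ∈ recordCoords F Mc k (recordK₀ F Mc k + n) X,
            recordChartJ F Mc k (recordK₀ F Mc k + n) X (ιC k n B) i =
              recordAct F (recordK₀ F Mc k + n) g (recordChartJ F Mc k (recordK₀ F Mc k + n) X (recordEmbJ F θ k (recordK₀ F Mc k + n) B)) i) →
      (∀ k : ℕ, (∀ n : ℕ, ContDiffAt ℝ 2 (ιC k n) 0 ∧ ιC k n 0 = 0) ∧
          ∀ (n : ℕ) (a : θ.ιβ) (l : RespLabel F k (recordK₀ F Mc k + n)),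
            recordGkLocWξ F θ k (recordK₀ F Mc k + n) Finset.univ a l = fun i => fderiv ℝ (ιC k n) 0 (Pi.single l.1 (Pi.single l.2 (θ.bV a))) i) →
      RecordPvolContOnBoxAx F a₀ ε₂₉ γ₀ → RecordPlimMomentNegPartOnBoxAx F a₀ ε₂₉ γ₀ e → CofinalBetaSocketAxBody F a := by
  intro F a₀ ε₂₉ γ₀ α₀ α₁ ha₀ hle hγ₀ hγh hε hα₀ hα₁ Mc hMc hMg4 ιC h8 hsw h9 hc hneg
  have hMc0 : (0 : ℝ) < Mc := by exact_mod_cast mc_pos hMc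
  have hMgMc : (Mc : ℝ) ≤ Mg := by linarith
  have hκ : 0 < κ := lt_of_lt_of_le (mul_pos (by norm_num) kappa₀_std_pos) hκ₀
  obtain ⟨C, δ₁, -, hdec⟩ := plimDecayOnBoxOf_LocUniv_images_geom hE₀ hκ₀ F a₀ ε₂₉ γ₀ α₀ α₁ hε hα₀ hα₁ Mc hMc hMg4 ιC h8 hsw h9
  obtain ⟨C₉', δ₀', -, -, hE⟩ :=
    twoVolExpBox_LocUniv_images_geom (c₁ := 0) hE₀ hκ hκ₀ le_rfl F a₀ ε₂₉ γ₀ α₀ α₁ hε hα₀ hα₁ Mc hMc hMgMc ιC h8 hsw h9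
  have hlim := polLimitOnBoxOf_of_twoVolExpLocUnif F a₀ ε₂₉ hE
  have hu := recordPvolLocUniformCauchyOnBoxAx_of_twoVolExpLocUnif F a₀ ε₂₉ hE
  exact cofinalBetaSocketAxBody_of_plimBoxLetters F a₀ ε₂₉ ha₀ hle hγ₀ hγh hε
    (recordPlimAbsMomentOnBoxAx_of_plimDecayOnBoxOf F a₀ ε₂₉ hdec) (recordPlimContOnBoxAx_of_pvol_loc F a₀ ε₂₉ hlim hc hu)
    (recordPlimMomentDominatedOnBoxAx_of_decayBox F a₀ ε₂₉ fun k => ⟨C, δ₁, hdec.1, fun v hv => hdec.2 k v hv⟩) hneg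

/-- ★★ **… WITH THE EVENTUAL SIGN (L-AF-box) IN PLACE OF (L-negpart-box)** (✓`cofinalBetaSocketAxBody_of_plimBoxLetters_eventuallyNonneg`).  CONDITIONAL; nothing asserted; the
Yang–Mills mass gap is NOT proved. [cite: Balaban1987RG1, Thm 2 (0.31) p.259, Thm 3 p.264, (1.22) p.264, (5.10) p.293, (5.44) p.297] -/
theorem cofinalBetaSocketAxBody_of_chartRowsBox_contBox_eventuallyNonneg {E₀ κ Mg a : ℝ} {k₀ : ℕ}
    (hE₀ : 0 ≤ E₀) (hκ₀ : 4 * B12TreeDecay.kappa₀ (4 * 2 ^ 4) (2 * 4) ≤ κ) :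
    ∀ (F : T4Family) (a₀ ε₂₉ γ₀ α₀ α₁ : ℝ), 0 < a₀ → a₀ ≤ a → 0 < γ₀ → γ₀ ≤ 1 / 2 → 0 < ε₂₉ → 0 < α₀ → 0 < α₁ →
      ∀ Mc : ℕ, McGuard F Mc → 4 * (Mc : ℝ) ≤ Mg →
      letI θ := thetaFill F a₀ ε₂₉; letI := θ.instVβ₁; letI := θ.instVβ₂; letI := θ.instιβ
      ∀ ιC : (k n : ℕ) → recordW F a₀ ε₂₉ k (recordK₀ F Mc k + n) → (Fin (recordChartDimJ F (recordK₀ F Mc k + n)) → ℂ),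
      (∀ (k : ℕ) (v : Fin (k + 1) → ℝ), v ∈ FlowStep.Box γ₀ k →
        B12FormatPlus.FormatPlusG (fun n => recordDomSys F Mc k (recordK₀ F Mc k + n)) (fun n => recordBondCount F (recordK₀ F Mc k + n))
          (fun n => recordAct F (recordK₀ F Mc k + n)) (fun n => recordUc F Mc k α₀ α₁ (recordK₀ F Mc k + n))
          (fun n => recordCoords F Mc k (recordK₀ F Mc k + n)) (fun n => recordChartDimJ F (recordK₀ F Mc k + n))
          (fun n => recordChartJ F Mc k (recordK₀ F Mc k + n)) (fun n => recordΦfAx F a₀ ε₂₉ k v (recordK₀ F Mc k + n))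
          (fun n => recordEmbJ F θ k (recordK₀ F Mc k + n)) (fun n => recordWrapCtr F Mc k (recordK₀ F Mc k + n))
          (fun n => recordDomEmbCtr F Mc k (recordK₀ F Mc k + n)) (fun n _ => recordCoordProjCtr F (recordK₀ F Mc k + n)) E₀ κ) →
      (∀ (k n : ℕ), ∀ᶠ B in 𝓝 (0 : recordW F a₀ ε₂₉ k (recordK₀ F Mc k + n)), ∀ X : (recordDomSys F Mc k (recordK₀ F Mc k + n)).Dom,
          ∃ g : recordGaugeGrp F (recordK₀ F Mc k + n), ∀ i ∈ recordCoords F Mc k (recordK₀ F Mc k + n) X,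
            recordChartJ F Mc k (recordK₀ F Mc k + n) X (ιC k n B) i =
              recordAct F (recordK₀ F Mc k + n) g (recordChartJ F Mc k (recordK₀ F Mc k + n) X (recordEmbJ F θ k (recordK₀ F Mc k + n) B)) i) →
      (∀ k : ℕ, (∀ n : ℕ, ContDiffAt ℝ 2 (ιC k n) 0 ∧ ιC k n 0 = 0) ∧
          ∀ (n : ℕ) (a : θ.ιβ) (l : RespLabel F k (recordK₀ F Mc k + n)),
            recordGkLocWξ F θ k (recordK₀ F Mc k + n) Finset.univ a l = fun i => fderiv ℝ (ιC k n) 0 (Pi.single l.1 (Pi.single l.2 (θ.bV a))) i) →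
      RecordPvolContOnBoxAx F a₀ ε₂₉ γ₀ → RecordPlimMomentEventuallyNonnegOnBoxAx F a₀ ε₂₉ γ₀ k₀ → CofinalBetaSocketAxBody F a := by
  intro F a₀ ε₂₉ γ₀ α₀ α₁ ha₀ hle hγ₀ hγh hε hα₀ hα₁ Mc hMc hMg4 ιC h8 hsw h9 hc hev
  have hMc0 : (0 : ℝ) < Mc := by exact_mod_cast mc_pos hMc
  have hMgMc : (Mc : ℝ) ≤ Mg := by linarith
  have hκ : 0 < κ := lt_of_lt_of_le (mul_pos (by norm_num) kappa₀_std_pos) hκ₀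
  obtain ⟨C, δ₁, -, hdec⟩ := plimDecayOnBoxOf_LocUniv_images_geom hE₀ hκ₀ F a₀ ε₂₉ γ₀ α₀ α₁ hε hα₀ hα₁ Mc hMc hMg4 ιC h8 hsw h9
  obtain ⟨C₉', δ₀', -, -, hE⟩ :=
    twoVolExpBox_LocUniv_images_geom (c₁ := 0) hE₀ hκ hκ₀ le_rfl F a₀ ε₂₉ γ₀ α₀ α₁ hε hα₀ hα₁ Mc hMc hMgMc ιC h8 hsw h9
  have hlim := polLimitOnBoxOf_of_twoVolExpLocUnif F a₀ ε₂₉ hE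
  have hu := recordPvolLocUniformCauchyOnBoxAx_of_twoVolExpLocUnif F a₀ ε₂₉ hE
  exact cofinalBetaSocketAxBody_of_plimBoxLetters_eventuallyNonneg F a₀ ε₂₉ ha₀ hle hγ₀ hγh hε
    (recordPlimAbsMomentOnBoxAx_of_plimDecayOnBoxOf F a₀ ε₂₉ hdec) (recordPlimContOnBoxAx_of_pvol_loc F a₀ ε₂₉ hlim hc hu)
    (recordPlimMomentDominatedOnBoxAx_of_decayBox F a₀ ε₂₉ fun k => ⟨C, δ₁, hdec.1, fun v hv => hdec.2 k v hv⟩) hev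

/-! ## §11i  The junction's binder `hβc` at cofinal radii — NO MOMENT, NO DECAY, NO (1.21) LETTER, NO TOKEN displayed -/

/-- ★ **THE JUNCTION's `hβc` FROM D1-box + THE CHART ROWS AT COFINALLY SMALL RADII — NO TOKEN**: §11g's antecedent enlarged by the two letters the rows do not pay — the finite-volume
continuity (V-cont-box) and a signed floor letter (L-negpart-box) `e` — inhabits `∀ F a, 0 < a → CofinalBetaSocketAxBody F a`, i.e. VERBATIM the body of the binder `hβc` of
`N24K0K1JunctionOfCofinalBetaSocketAx.k0BoxCofinalRadiiAx_of_cofinalBetaSocketAx` (✓`…K0AxMomentBoxSocket` :74); K0ᴬ follows by ✓`record13SepCoPHInhabitedAx_of_cofinalBetaSocketAxBody`,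
(α_cof)-Ax by ✓`k0BoxCofinalRadiiAx_of_cofinalBetaSocketAxBody`.  CONDITIONAL door: every conjunct of `H` is OPEN content; the junction's consumer, K0ᴬ 27238, K1ᴬ, K3ᴬ remain OPEN;
NODE O 0∕1; the Yang–Mills mass gap is NOT proved. [cite: Balaban1987RG1, Thm 1 p.259, Thm 2 (0.31) p.259, Thm 3 p.264, (0.20) p.256, (1.18)–(1.22) pp.263–264, (4.35)–(4.37) pp.290–291, (5.10) p.293, (5.38)–(5.44) pp.296–297; Balaban1985Variational, Prop. 9 p.309] -/
theorem cofinalBetaSocketAxBody_allRadii_of_chartRowsBox_contBox_negPart_cofinalRadii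
    (H : ∀ F : T4Family, ∀ a : ℝ, 0 < a → ∃ a₀ : ℝ, 0 < a₀ ∧ a₀ ≤ a ∧ ∃ (γ₀ ε₂₉ E₀ κ Mg α₀ α₁ : ℝ) (Mc : ℕ) (e : ℕ → ℝ),
      0 < γ₀ ∧ γ₀ ≤ 1 / 2 ∧ 0 < ε₂₉ ∧ 0 ≤ E₀ ∧ 4 * B12TreeDecay.kappa₀ (4 * 2 ^ 4) (2 * 4) ≤ κ ∧ 0 < α₀ ∧ 0 < α₁ ∧ McGuard F Mc ∧ 4 * (Mc : ℝ) ≤ Mg ∧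
      RecordPvolContOnBoxAx F a₀ ε₂₉ γ₀ ∧ RecordPlimMomentNegPartOnBoxAx F a₀ ε₂₉ γ₀ e ∧
      (letI θ := thetaFill F a₀ ε₂₉; letI := θ.instVβ₁; letI := θ.instVβ₂; letI := θ.instιβ;
        ∃ ιC : (k n : ℕ) → recordW F a₀ ε₂₉ k (recordK₀ F Mc k + n) → (Fin (recordChartDimJ F (recordK₀ F Mc k + n)) → ℂ),
        (∀ (k : ℕ) (v : Fin (k + 1) → ℝ), v ∈ FlowStep.Box γ₀ k →
          B12FormatPlus.FormatPlusG (fun n => recordDomSys F Mc k (recordK₀ F Mc k + n)) (fun n => recordBondCount F (recordK₀ F Mc k + n))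
            (fun n => recordAct F (recordK₀ F Mc k + n)) (fun n => recordUc F Mc k α₀ α₁ (recordK₀ F Mc k + n))
            (fun n => recordCoords F Mc k (recordK₀ F Mc k + n)) (fun n => recordChartDimJ F (recordK₀ F Mc k + n))
            (fun n => recordChartJ F Mc k (recordK₀ F Mc k + n)) (fun n => recordΦfAx F a₀ ε₂₉ k v (recordK₀ F Mc k + n))
            (fun n => recordEmbJ F θ k (recordK₀ F Mc k + n)) (fun n => recordWrapCtr F Mc k (recordK₀ F Mc k + n))
            (fun n => recordDomEmbCtr F Mc k (recordK₀ F Mc k + n)) (fun n _ => recordCoordProjCtr F (recordK₀ F Mc k + n)) E₀ κ) ∧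
        (∀ (k n : ℕ), ∀ᶠ B in 𝓝 (0 : recordW F a₀ ε₂₉ k (recordK₀ F Mc k + n)), ∀ X : (recordDomSys F Mc k (recordK₀ F Mc k + n)).Dom,
            ∃ g : recordGaugeGrp F (recordK₀ F Mc k + n), ∀ i ∈ recordCoords F Mc k (recordK₀ F Mc k + n) X,
              recordChartJ F Mc k (recordK₀ F Mc k + n) X (ιC k n B) i =
                recordAct F (recordK₀ F Mc k + n) g (recordChartJ F Mc k (recordK₀ F Mc k + n) X (recordEmbJ F θ k (recordK₀ F Mc k + n) B)) i) ∧
        (∀ k : ℕ, (∀ n : ℕ, ContDiffAt ℝ 2 (ιC k n) 0 ∧ ιC k n 0 = 0) ∧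
            ∀ (n : ℕ) (a : θ.ιβ) (l : RespLabel F k (recordK₀ F Mc k + n)),
              recordGkLocWξ F θ k (recordK₀ F Mc k + n) Finset.univ a l = fun i => fderiv ℝ (ιC k n) 0 (Pi.single l.1 (Pi.single l.2 (θ.bV a))) i))) :
    ∀ F : T4Family, ∀ a : ℝ, 0 < a → CofinalBetaSocketAxBody F a := by
  intro F a ha
  obtain ⟨a₀, ha₀, hle, γ₀, ε₂₉, E₀, κ, Mg, α₀, α₁, Mc, e, hγ₀, hγh, hε, hE₀, hκ₀, hα₀, hα₁, hMc, hMg4, hc, hneg, ιC, h8, hsw, h9⟩ := H F a ha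
  exact cofinalBetaSocketAxBody_of_chartRowsBox_contBox_negPart hE₀ hκ₀ F a₀ ε₂₉ γ₀ α₀ α₁ ha₀ hle hγ₀ hγh hε hα₀ hα₁ Mc hMc hMg4 ιC h8 hsw h9 hc hneg

/-- ★ **… hence K0ᴬ BY NAME through the junction body** (= §11g by another road; recorded so the junction edition and the K0ᴬ edition are visibly ONE supply). CONDITIONAL; K0ᴬ OPEN;
the Yang–Mills mass gap is NOT proved. [cite: Balaban1987RG1, Thm 1 p.259, Thm 3 p.264 (bookkeeping)] -/
theorem record13SepCoPHInhabitedAx_of_chartRowsBox_contBox_negPart_cofinalRadii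
    (H : ∀ F : T4Family, ∀ a : ℝ, 0 < a → ∃ a₀ : ℝ, 0 < a₀ ∧ a₀ ≤ a ∧ ∃ (γ₀ ε₂₉ E₀ κ Mg α₀ α₁ : ℝ) (Mc : ℕ) (e : ℕ → ℝ),
      0 < γ₀ ∧ γ₀ ≤ 1 / 2 ∧ 0 < ε₂₉ ∧ 0 ≤ E₀ ∧ 4 * B12TreeDecay.kappa₀ (4 * 2 ^ 4) (2 * 4) ≤ κ ∧ 0 < α₀ ∧ 0 < α₁ ∧ McGuard F Mc ∧ 4 * (Mc : ℝ) ≤ Mg ∧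
      RecordPvolContOnBoxAx F a₀ ε₂₉ γ₀ ∧ RecordPlimMomentNegPartOnBoxAx F a₀ ε₂₉ γ₀ e ∧
      (letI θ := thetaFill F a₀ ε₂₉; letI := θ.instVβ₁; letI := θ.instVβ₂; letI := θ.instιβ;
        ∃ ιC : (k n : ℕ) → recordW F a₀ ε₂₉ k (recordK₀ F Mc k + n) → (Fin (recordChartDimJ F (recordK₀ F Mc k + n)) → ℂ),
        (∀ (k : ℕ) (v : Fin (k + 1) → ℝ), v ∈ FlowStep.Box γ₀ k →
          B12FormatPlus.FormatPlusG (fun n => recordDomSys F Mc k (recordK₀ F Mc k + n)) (fun n => recordBondCount F (recordK₀ F Mc k + n))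
            (fun n => recordAct F (recordK₀ F Mc k + n)) (fun n => recordUc F Mc k α₀ α₁ (recordK₀ F Mc k + n))
            (fun n => recordCoords F Mc k (recordK₀ F Mc k + n)) (fun n => recordChartDimJ F (recordK₀ F Mc k + n))
            (fun n => recordChartJ F Mc k (recordK₀ F Mc k + n)) (fun n => recordΦfAx F a₀ ε₂₉ k v (recordK₀ F Mc k + n))
            (fun n => recordEmbJ F θ k (recordK₀ F Mc k + n)) (fun n => recordWrapCtr F Mc k (recordK₀ F Mc k + n))
            (fun n => recordDomEmbCtr F Mc k (recordK₀ F Mc k + n)) (fun n _ => recordCoordProjCtr F (recordK₀ F Mc k + n)) E₀ κ) ∧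
        (∀ (k n : ℕ), ∀ᶠ B in 𝓝 (0 : recordW F a₀ ε₂₉ k (recordK₀ F Mc k + n)), ∀ X : (recordDomSys F Mc k (recordK₀ F Mc k + n)).Dom,
            ∃ g : recordGaugeGrp F (recordK₀ F Mc k + n), ∀ i ∈ recordCoords F Mc k (recordK₀ F Mc k + n) X,
              recordChartJ F Mc k (recordK₀ F Mc k + n) X (ιC k n B) i =
                recordAct F (recordK₀ F Mc k + n) g (recordChartJ F Mc k (recordK₀ F Mc k + n) X (recordEmbJ F θ k (recordK₀ F Mc k + n) B)) i) ∧
        (∀ k : ℕ, (∀ n : ℕ, ContDiffAt ℝ 2 (ιC k n) 0 ∧ ιC k n 0 = 0) ∧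
            ∀ (n : ℕ) (a : θ.ιβ) (l : RespLabel F k (recordK₀ F Mc k + n)),
              recordGkLocWξ F θ k (recordK₀ F Mc k + n) Finset.univ a l = fun i => fderiv ℝ (ιC k n) 0 (Pi.single l.1 (Pi.single l.2 (θ.bV a))) i))) :
    Summit.QuantumFields.YangMills.Theses.BalabanUVNodes.Record13SepCoPHInhabitedAx :=
  record13SepCoPHInhabitedAx_of_cofinalBetaSocketAxBody (cofinalBetaSocketAxBody_allRadii_of_chartRowsBox_contBox_negPart_cofinalRadii H)

/-- ★ **… and the (L-AF-box) edition of the same door** (puts §11h's eventual-sign theorem on an edge: the cofinal-radii supply with `∃ k₀, RecordPlimMomentEventuallyNonnegOnBoxAx … γ₀ k₀` in place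
of `∃ e, (L-negpart-box e)` ⟹ the junction body at every radius ⟹ K0ᴬ BY NAME, ✓`record13SepCoPHInhabitedAx_of_cofinalBetaSocketAxBody`).  CONDITIONAL; K0ᴬ OPEN; the Yang–Mills mass gap
is NOT proved. [cite: Balaban1987RG1, Thm 1 p.259, Thm 2 (0.31) p.259, Thm 3 p.264, (1.22) p.264, (5.10) p.293, (5.44) p.297] -/
theorem record13SepCoPHInhabitedAx_of_chartRowsBox_contBox_eventuallyNonneg_cofinalRadii
    (H : ∀ F : T4Family, ∀ a : ℝ, 0 < a → ∃ a₀ : ℝ, 0 < a₀ ∧ a₀ ≤ a ∧ ∃ (γ₀ ε₂₉ E₀ κ Mg α₀ α₁ : ℝ) (Mc k₀ : ℕ),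
      0 < γ₀ ∧ γ₀ ≤ 1 / 2 ∧ 0 < ε₂₉ ∧ 0 ≤ E₀ ∧ 4 * B12TreeDecay.kappa₀ (4 * 2 ^ 4) (2 * 4) ≤ κ ∧ 0 < α₀ ∧ 0 < α₁ ∧ McGuard F Mc ∧ 4 * (Mc : ℝ) ≤ Mg ∧
      RecordPvolContOnBoxAx F a₀ ε₂₉ γ₀ ∧ RecordPlimMomentEventuallyNonnegOnBoxAx F a₀ ε₂₉ γ₀ k₀ ∧
      (letI θ := thetaFill F a₀ ε₂₉; letI := θ.instVβ₁; letI := θ.instVβ₂; letI := θ.instιβ;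
        ∃ ιC : (k n : ℕ) → recordW F a₀ ε₂₉ k (recordK₀ F Mc k + n) → (Fin (recordChartDimJ F (recordK₀ F Mc k + n)) → ℂ),
        (∀ (k : ℕ) (v : Fin (k + 1) → ℝ), v ∈ FlowStep.Box γ₀ k →
          B12FormatPlus.FormatPlusG (fun n => recordDomSys F Mc k (recordK₀ F Mc k + n)) (fun n => recordBondCount F (recordK₀ F Mc k + n))
            (fun n => recordAct F (recordK₀ F Mc k + n)) (fun n => recordUc F Mc k α₀ α₁ (recordK₀ F Mc k + n))
            (fun n => recordCoords F Mc k (recordK₀ F Mc k + n)) (fun n => recordChartDimJ F (recordK₀ F Mc k + n))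
            (fun n => recordChartJ F Mc k (recordK₀ F Mc k + n)) (fun n => recordΦfAx F a₀ ε₂₉ k v (recordK₀ F Mc k + n))
            (fun n => recordEmbJ F θ k (recordK₀ F Mc k + n)) (fun n => recordWrapCtr F Mc k (recordK₀ F Mc k + n))
            (fun n => recordDomEmbCtr F Mc k (recordK₀ F Mc k + n)) (fun n _ => recordCoordProjCtr F (recordK₀ F Mc k + n)) E₀ κ) ∧
        (∀ (k n : ℕ), ∀ᶠ B in 𝓝 (0 : recordW F a₀ ε₂₉ k (recordK₀ F Mc k + n)), ∀ X : (recordDomSys F Mc k (recordK₀ F Mc k + n)).Dom,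
            ∃ g : recordGaugeGrp F (recordK₀ F Mc k + n), ∀ i ∈ recordCoords F Mc k (recordK₀ F Mc k + n) X,
              recordChartJ F Mc k (recordK₀ F Mc k + n) X (ιC k n B) i =
                recordAct F (recordK₀ F Mc k + n) g (recordChartJ F Mc k (recordK₀ F Mc k + n) X (recordEmbJ F θ k (recordK₀ F Mc k + n) B)) i) ∧
        (∀ k : ℕ, (∀ n : ℕ, ContDiffAt ℝ 2 (ιC k n) 0 ∧ ιC k n 0 = 0) ∧
            ∀ (n : ℕ) (a : θ.ιβ) (l : RespLabel F k (recordK₀ F Mc k + n)),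
              recordGkLocWξ F θ k (recordK₀ F Mc k + n) Finset.univ a l = fun i => fderiv ℝ (ιC k n) 0 (Pi.single l.1 (Pi.single l.2 (θ.bV a))) i))) :
    Summit.QuantumFields.YangMills.Theses.BalabanUVNodes.Record13SepCoPHInhabitedAx := by
  refine record13SepCoPHInhabitedAx_of_cofinalBetaSocketAxBody fun F a ha => ?_
  obtain ⟨a₀, ha₀, hle, γ₀, ε₂₉, E₀, κ, Mg, α₀, α₁, Mc, k₀, hγ₀, hγh, hε, hE₀, hκ₀, hα₀, hα₁, hMc, hMg4, hc, hev, ιC, h8, hsw, h9⟩ := H F a ha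
  exact cofinalBetaSocketAxBody_of_chartRowsBox_contBox_eventuallyNonneg hE₀ hκ₀ F a₀ ε₂₉ γ₀ α₀ α₁ ha₀ hle hγ₀ hγh hε hα₀ hα₁ Mc hMc hMg4 ιC
    h8 hsw h9 hc hev

-- standard axioms only
#print axioms record13SepCoPHInhabitedAx_of_chartRowsBox_contBox_negPart_cofinalRadii
#print axioms record13SepCoPHInhabitedAx_of_chartRowsBox_contBox_eventuallyNonneg_cofinalRadii

end Summit.QuantumFields.YangMills.Theorems.K0AxMomentRoad

end
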